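import Literature.MathematicalPhysics.QuantumFieldTheory.BalabanImbrieJaffe1984to88.BIJ88EffectiveAction308
import Literature.MathematicalPhysics.QuantumFieldTheory.BalabanImbrieJaffe1984to88.BIJ88Sect5StatementsPart4
import Mathlib.Analysis.Calculus.FDeriv.Extend

/-!
# `BalabanImbrieJaffe1984to88.BIJ88PertTerms5141` — T. Bałaban, J. Imbrie, A. Jaffe, *Effective action and cluster properties of the
abelian Higgs model*, Commun. Math. Phys. **114** (1988) 257–315 [BalabanImbrieJaffe1988]: Sect. 5.14, p. 308 [PDF 52], verbatim
(page render `lit-balaban-r16/renders/cmp114/original-p052-x2.png` read as an image): *"Define z_t(Λ₁₂^{(k)}) for t ∈ [0,1] by … .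
Thus the restrictions and the interactions disappear at t = 0, at which point we have a purely Gaussian expectation. Thus we define
perturbative terms for the action, 𝒫_{k+1}(Λ₁₂^{(k)}) = Σ_{α=1}^{n̄} −(1/α!)(dᵅ/dtᵅ) log z_t(Λ₁₂^{(k)})|_{t=0}, (5.14.1) and a remainder
ℛ_k(Λ₁₂^{(k)}) = ∫₀¹ dt −((1−t)^{n̄}/(n̄+1)!) ⟨d/dt; …; d/dt⟩_t. (5.14.2)"* — **`t ↦ log z_t` IS `C^∞` ON THE CLOSED INTERVAL `[0,1]`
and (5.14.1)–(5.14.2) hold AS TYPED by the row owner (`BIJ88Sect5StatementsPart4.pertP` / `taylor_logz`: derivatives AT `t = 0` WITHIN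
`[0,1]`)** for the restricted interacting family `z(t) = ∫ χ′_{Λ,t}·e^{−tW} dP` of this seat's p. 308 chain.

statement-level skeleton of published theorems with citation tags; proofs where landed; nothing here is a claim about the Yang–Mills mass gap

WHAT THIS FILE ADDS (theorems only; no definitions, no `Prop` facts; axioms standard).  The gen-7 files reach print's `𝒫_{k+1}` through
LIMITS `t → 0⁺` of `(dᵅ/dtᵅ) log z_t` (`BIJ88GaussianMoments308`: the limits are the cumulants of `−Ṽ` in the Gaussian `t = 0` measure);
print — and the row owner's typed leaf `pertP logz n̄ = Σ_{α<n̄} −(1/(α+1)!)·iteratedDerivWithin (α+1) logz [0,1] 0` — take the derivatives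
AT `t = 0` of a family on the CLOSED interval.  Here:
* §1 `t = 0`: the Lean expression `z_0 = ∫ Π_b χ(c_b·p(0·e_k), Φ_b)·e^{0} dP` evaluates — through `p(0) = |log 0⁻¹|^p = 0` and
  `χ(0, x) = χ(1, x/0) = χ(1, 0) = 1` — to EXACTLY print's convention *"the restrictions and the interactions disappear at t = 0"*:
  `z_0 = 1`, `log z_0 = 0` (`integral_restrictedInteraction_at_zero`), which is also the continuous extension
  (`BIJ88RestrictedInteraction308.tendsto_integral_restrictedInteraction_zero`).
* §2 **one-sided smoothness at the Gaussian point**: every within-`[0,1]` iterated derivative of `log z_t` at `t = 0` exists and equals the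
  Gaussian cumulant, `iteratedDerivWithin α (log z) [0,1] 0 = (dᵅ/dtᵅ)|₀ cgf_{−W}` (`iteratedDerivWithin_log_restrictedInteraction_zero`, by
  induction on `α` with Mathlib's endpoint lemma `hasDerivWithinAt_Ici_of_tendsto_deriv` fed by the gen-7 limits); each
  `iteratedDerivWithin α (log z) [0,1]` is right-differentiable at `0` and differentiable on `[0,1]`; hence **`log z ∈ Cⁿ([0,1])` for
  every `n`** (`contDiffOn_Icc_log_restrictedInteraction`, Mathlib `contDiffOn_succ_iff_derivWithin`).
* §3 **the typed leaves inhabited by the actual family**: `pertP (log z) n̄ = pertPart n̄ (cgf_{−W})` (`pertP_restrictedInteraction` — print's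
  `𝒫_{k+1}` AS TYPED equals the Gaussian-cumulant sum of the gen-7/8 theorems), the row owner's `taylor_logz` applies verbatim
  (`taylor_logz_restrictedInteraction`: `log z₁ = −pertP (log z) n̄ + ∫₀¹ ((1−t)^{n̄}/n̄!)·iteratedDerivWithin (n̄+1) (log z) [0,1] t dt`), and
  for a non-negative profile and centered jointly Gaussian fields (`BIJ88ZtPositivity308`, `BIJ88EffectiveAction308`) all of this holds with
  no standing hypothesis (`…'` forms; `effectiveAction_eq_pertP_sub_remainder`).
Hypotheses of §2: those of the gen-7 chain (centered Gaussian marginals with variances `≤ v`, thresholds `c_b ≥ c₀ > 0`, `p > 1/2`,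
`0 < e_k < e^{−1}`, measurable `|W| ≤ K`, `z_t ≠ 0` on `(0,1]`).

PDF held: `paper:balaban1988-cmp114-bij-abelian-higgs-effective-action` (journal page = PDF page + 256); p. 308 [PDF 52].

CITATION HEADER (lean-in-tree rule).  Part of the lit-balaban TYPED SKELETON (HOME `run/shared/lean/pub/lit-balaban/`), Phase 2,
seat p36 (gen 8, unit `lit-balaban-p36`); row **C2.Eq5.14.1-5.14.2** of `HOME/lit-balaban-r16/ROWS-C2-part2.md` (owner r16; typed leaves
`BIJ88Sect5StatementsPart4.pertP`/`remR`/`taylor_logz` USED, not modified).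
-/

namespace Literature.MathematicalPhysics.QuantumFieldTheory.BalabanImbrieJaffe1984to88.BIJ88PertTerms5141

open MeasureTheory ProbabilityTheory Filter Set intervalIntegral
open scoped Nat Topology
open BIJ88Sect2Statements (pLog)
open BIJ88Sect5Statements (CutoffProfile cutoff)
open BIJ88Sect5StatementsPart4 (pertP)
open BIJ88Perturbative341 (pertPart)

/-! ## §1 `t = 0`: the restrictions and the interaction disappear -/

section AtZero

variable (χ : CutoffProfile) {ι Ω : Type*} [MeasurableSpace Ω]

/-- `p(0) = |log 0⁻¹|^p = 0` for `p ≠ 0` (Lean's `0⁻¹ = 0`, `log 0 = 0`); at `t = 0` the radius argument is `0·e_k = 0`.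
[cite: BalabanImbrieJaffe1988, (2.33) p.263] -/
theorem pLog_zero {p : ℝ} (hp : p ≠ 0) : pLog p 0 = 0 := by
  simp [pLog, Real.zero_rpow hp]

/-- `χ(0, x) = χ(1, x/0) = χ(1, 0) = 1`: at radius `0` the Lean cut-off evaluates to print's `t = 0` convention (no restriction).
[cite: BalabanImbrieJaffe1988, (5.2.4) p.278] -/
theorem cutoff_zero_radius (x : ℝ) : cutoff χ 0 x = 1 := by
  unfold cutoff
  rw [div_zero]
  exact χ.eq_one 0 (by norm_num)

/-- **`z_0 = 1`**: *"the restrictions and the interactions disappear at t = 0, at which point we have a purely Gaussian expectation"* —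
the Lean expression at `t = 0` IS print's convention (`p ≠ 0`, probability measure). [cite: BalabanImbrieJaffe1988, (5.14.1) p.308] -/
theorem integral_restrictedInteraction_at_zero {p : ℝ} (hp : p ≠ 0) (P : Measure Ω) [IsProbabilityMeasure P] (B : Finset ι)
    (Φ : ι → Ω → ℝ) (c : ι → ℝ) (W : Ω → ℝ) (ek : ℝ) :
    (∫ ω, (∏ b ∈ B, cutoff χ (c b * pLog p (0 * ek)) (Φ b ω)) * Real.exp (-(0 * W ω)) ∂P) = 1 := by
  simp [pLog_zero hp, cutoff_zero_radius]

/-- Hence `log z_0 = 0 = cgf_{−W}(0)`. [cite: BalabanImbrieJaffe1988, (5.14.1) p.308] -/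
theorem log_integral_restrictedInteraction_at_zero {p : ℝ} (hp : p ≠ 0) (P : Measure Ω) [IsProbabilityMeasure P] (B : Finset ι)
    (Φ : ι → Ω → ℝ) (c : ι → ℝ) (W : Ω → ℝ) (ek : ℝ) :
    Real.log (∫ ω, (∏ b ∈ B, cutoff χ (c b * pLog p (0 * ek)) (Φ b ω)) * Real.exp (-(0 * W ω)) ∂P) =
      cgf (fun ω => -W ω) P 0 := by
  rw [integral_restrictedInteraction_at_zero χ hp, Real.log_one, cgf_zero]

end AtZero

/-! ## §2 One-sided iterated derivatives at `t = 0`; `log z ∈ C^∞([0,1])` -/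

section OneSided

/-- `Cⁿ⁺¹` at a point ⇒ the `n`-th derivative is differentiable there. [cite: BalabanImbrieJaffe1988, (5.14.1) p.308] -/
theorem differentiableAt_iteratedDeriv_of_contDiffAt {f : ℝ → ℝ} {n : ℕ} {x : ℝ} (hf : ContDiffAt ℝ (n + 1) f x) :
    DifferentiableAt ℝ (iteratedDeriv n f) x := by
  rw [iteratedDeriv_eq_equiv_comp]
  have h := (hf.iteratedFDeriv_right (m := 1) (i := n) (by rw [add_comm])).differentiableAt one_ne_zero
  exact (LinearIsometryEquiv.differentiable _).differentiableAt.comp x h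

variable (χ : CutoffProfile) {ι Ω : Type*} [MeasurableSpace Ω]

/-- On `(0,1]` the within-`[0,1]` iterated derivatives of `log z_t` are the ordinary ones (`e_k < e^{−1}`, `z_t ≠ 0` there).
[cite: BalabanImbrieJaffe1988, (5.14.1) p.308] -/
theorem iteratedDerivWithin_Icc_log_restrictedInteraction (p : ℝ) (μ : Measure Ω) [IsFiniteMeasure μ] (B : Finset ι)
    {Φ : ι → Ω → ℝ} (hΦ : ∀ b ∈ B, Measurable (Φ b)) {c : ι → ℝ} (hc : ∀ b ∈ B, c b ≠ 0) {W : Ω → ℝ} (hW : Measurable W)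
    {K : ℝ} (hK : ∀ ω, |W ω| ≤ K) {ek : ℝ} (hek : 0 < ek) (hek1 : ek < Real.exp (-1))
    (hz : ∀ t ∈ Set.Ioc (0 : ℝ) 1, (∫ ω, (∏ b ∈ B, cutoff χ (c b * pLog p (t * ek)) (Φ b ω)) * Real.exp (-(t * W ω)) ∂μ) ≠ 0)
    (α : ℕ) {t : ℝ} (ht : t ∈ Set.Ioc (0 : ℝ) 1) :
    iteratedDerivWithin α (fun t => Real.log
        (∫ ω, (∏ b ∈ B, cutoff χ (c b * pLog p (t * ek)) (Φ b ω)) * Real.exp (-(t * W ω)) ∂μ)) (Set.Icc 0 1) t =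
      iteratedDeriv α (fun t => Real.log
        (∫ ω, (∏ b ∈ B, cutoff χ (c b * pLog p (t * ek)) (Φ b ω)) * Real.exp (-(t * W ω)) ∂μ)) t :=
  iteratedDerivWithin_eq_iteratedDeriv (uniqueDiffOn_Icc zero_lt_one)
    (BIJ88PerturbativeRemainder308.contDiffAt_log_restrictedInteraction χ p μ B hΦ hc hW hK hek hek1 hz α ht) ⟨ht.1.le, ht.2⟩

/-- **Every one-sided iterated derivative of `t ↦ log z_t` at `t = 0` along `[0,1]` is the corresponding Gaussian cumulant of `−Ṽ`**:
`(dᵅ/dtᵅ)|_{t=0,[0,1]} log z_t = (dᵅ/dtᵅ)|₀ cgf_{−W}` for EVERY `α` — print's *"(dᵅ/dtᵅ) log z_t|_{t=0}"* of (5.14.1) for the restricted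
interacting family (centered Gaussian marginals, variances `≤ v`, `c_b ≥ c₀ > 0`, `p > 1/2`, `0 < e_k < e^{−1}`, measurable `|W| ≤ K`,
`z_t ≠ 0` on `(0,1]`); induction on `α` via Mathlib `hasDerivWithinAt_Ici_of_tendsto_deriv` and the gen-7 limits.
[cite: BalabanImbrieJaffe1988, (5.14.1) p.308] -/
theorem iteratedDerivWithin_log_restrictedInteraction_zero {p : ℝ} (hp : 1 / 2 < p) (P : Measure Ω) [IsProbabilityMeasure P]
    (B : Finset ι) {Φ : ι → Ω → ℝ} (hG : ∀ b ∈ B, HasGaussianLaw (Φ b) P) (hΦ : ∀ b ∈ B, Measurable (Φ b))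
    (h0 : ∀ b ∈ B, P[Φ b] = 0) {v : ℝ} (hv : 0 < v) (hvar : ∀ b ∈ B, Var[Φ b; P] ≤ v) {c : ι → ℝ} {c₀ : ℝ} (hc₀ : 0 < c₀)
    (hcb : ∀ b ∈ B, c₀ ≤ c b) {W : Ω → ℝ} (hW : Measurable W) {K : ℝ} (hK : ∀ ω, |W ω| ≤ K) {ek : ℝ} (hek : 0 < ek)
    (hek1 : ek < Real.exp (-1))
    (hz : ∀ t ∈ Set.Ioc (0 : ℝ) 1, (∫ ω, (∏ b ∈ B, cutoff χ (c b * pLog p (t * ek)) (Φ b ω)) * Real.exp (-(t * W ω)) ∂P) ≠ 0)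
    (α : ℕ) :
    iteratedDerivWithin α (fun t => Real.log
        (∫ ω, (∏ b ∈ B, cutoff χ (c b * pLog p (t * ek)) (Φ b ω)) * Real.exp (-(t * W ω)) ∂P)) (Set.Icc 0 1) 0 =
      iteratedDeriv α (cgf (fun ω => -W ω) P) 0 := by
  set f : ℝ → ℝ := fun t => Real.log
    (∫ ω, (∏ b ∈ B, cutoff χ (c b * pLog p (t * ek)) (Φ b ω)) * Real.exp (-(t * W ω)) ∂P) with hfdef
  have hcne : ∀ b ∈ B, c b ≠ 0 := fun b hb => (hc₀.trans_le (hcb b hb)).ne'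
  have hB : ∀ β : ℕ, ∀ t ∈ Set.Ioo (0 : ℝ) 1, iteratedDerivWithin β f (Set.Icc 0 1) t = iteratedDeriv β f t :=
    fun β t ht => iteratedDerivWithin_Icc_log_restrictedInteraction χ p P B hΦ hcne hW hK hek hek1 hz β ⟨ht.1, ht.2.le⟩
  have hlim : ∀ β : ℕ, Tendsto (iteratedDeriv β f) (𝓝[>] (0 : ℝ)) (𝓝 (iteratedDeriv β (cgf (fun ω => -W ω) P) 0)) :=
    fun β => BIJ88GaussianMoments308.tendsto_iteratedDeriv_log_restrictedInteraction_cgf χ hp P B hG hΦ h0 hv hvar hc₀ hcb hW hK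
      hek β
  induction α with
  | zero =>
    rw [iteratedDerivWithin_zero, iteratedDeriv_zero, hfdef]
    exact log_integral_restrictedInteraction_at_zero χ (by linarith : p ≠ 0) P B Φ c W ek
  | succ α ih =>
    rw [iteratedDerivWithin_succ]
    set g : ℝ → ℝ := iteratedDerivWithin α f (Set.Icc 0 1) with hgdef
    have hloc : ∀ t ∈ Set.Ioo (0 : ℝ) 1, g =ᶠ[𝓝 t] iteratedDeriv α f := fun t ht => by
      filter_upwards [isOpen_Ioo.mem_nhds ht] with s hs using hB α s hs
    have h1 : DifferentiableOn ℝ g (Set.Ioo 0 1) := fun t ht =>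
      ((hloc t ht).differentiableAt_iff.mpr (differentiableAt_iteratedDeriv_of_contDiffAt
        (BIJ88PerturbativeRemainder308.contDiffAt_log_restrictedInteraction χ p P B hΦ hcne hW hK hek hek1 hz (α + 1)
          ⟨ht.1, ht.2.le⟩))).differentiableWithinAt
    have h2 : ContinuousWithinAt g (Set.Ioo 0 1) 0 := by
      rw [ContinuousWithinAt, nhdsWithin_Ioo_eq_nhdsGT zero_lt_one, ih]
      refine (hlim α).congr' ?_
      filter_upwards [Ioo_mem_nhdsGT zero_lt_one] with t ht using (hB α t ht).symm
    have h3 : Tendsto (fun t => deriv g t) (𝓝[>] (0 : ℝ)) (𝓝 (iteratedDeriv (α + 1) (cgf (fun ω => -W ω) P) 0)) := by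
      refine (hlim (α + 1)).congr' ?_
      filter_upwards [Ioo_mem_nhdsGT zero_lt_one] with t ht
      rw [(hloc t ht).deriv_eq, iteratedDeriv_succ]
    have h4 : HasDerivWithinAt g (iteratedDeriv (α + 1) (cgf (fun ω => -W ω) P) 0) (Set.Icc 0 1) 0 :=
      (hasDerivWithinAt_Ici_of_tendsto_deriv h1 h2 (Ioo_mem_nhdsGT zero_lt_one) h3).mono Set.Icc_subset_Ici_self
    exact h4.derivWithin (uniqueDiffOn_Icc zero_lt_one 0 (Set.left_mem_Icc.mpr zero_le_one))

/-- **Right-differentiability at `t = 0` of every order**: along `[0,1]`, the `α`-th within-derivative of `log z_t` has the right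
derivative `(dᵅ⁺¹/dtᵅ⁺¹)|₀ cgf_{−W}` at `t = 0` (hypotheses as above). [cite: BalabanImbrieJaffe1988, (5.14.1) p.308] -/
theorem hasDerivWithinAt_iteratedDerivWithin_log_zero {p : ℝ} (hp : 1 / 2 < p) (P : Measure Ω) [IsProbabilityMeasure P]
    (B : Finset ι) {Φ : ι → Ω → ℝ} (hG : ∀ b ∈ B, HasGaussianLaw (Φ b) P) (hΦ : ∀ b ∈ B, Measurable (Φ b))
    (h0 : ∀ b ∈ B, P[Φ b] = 0) {v : ℝ} (hv : 0 < v) (hvar : ∀ b ∈ B, Var[Φ b; P] ≤ v) {c : ι → ℝ} {c₀ : ℝ} (hc₀ : 0 < c₀)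
    (hcb : ∀ b ∈ B, c₀ ≤ c b) {W : Ω → ℝ} (hW : Measurable W) {K : ℝ} (hK : ∀ ω, |W ω| ≤ K) {ek : ℝ} (hek : 0 < ek)
    (hek1 : ek < Real.exp (-1))
    (hz : ∀ t ∈ Set.Ioc (0 : ℝ) 1, (∫ ω, (∏ b ∈ B, cutoff χ (c b * pLog p (t * ek)) (Φ b ω)) * Real.exp (-(t * W ω)) ∂P) ≠ 0)
    (α : ℕ) :
    HasDerivWithinAt (iteratedDerivWithin α (fun t => Real.log
        (∫ ω, (∏ b ∈ B, cutoff χ (c b * pLog p (t * ek)) (Φ b ω)) * Real.exp (-(t * W ω)) ∂P)) (Set.Icc 0 1))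
      (iteratedDeriv (α + 1) (cgf (fun ω => -W ω) P) 0) (Set.Icc 0 1) 0 := by
  set f : ℝ → ℝ := fun t => Real.log
    (∫ ω, (∏ b ∈ B, cutoff χ (c b * pLog p (t * ek)) (Φ b ω)) * Real.exp (-(t * W ω)) ∂P) with hfdef
  have hcne : ∀ b ∈ B, c b ≠ 0 := fun b hb => (hc₀.trans_le (hcb b hb)).ne'
  have hB : ∀ β : ℕ, ∀ t ∈ Set.Ioo (0 : ℝ) 1, iteratedDerivWithin β f (Set.Icc 0 1) t = iteratedDeriv β f t :=
    fun β t ht => iteratedDerivWithin_Icc_log_restrictedInteraction χ p P B hΦ hcne hW hK hek hek1 hz β ⟨ht.1, ht.2.le⟩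
  have hlim : ∀ β : ℕ, Tendsto (iteratedDeriv β f) (𝓝[>] (0 : ℝ)) (𝓝 (iteratedDeriv β (cgf (fun ω => -W ω) P) 0)) :=
    fun β => BIJ88GaussianMoments308.tendsto_iteratedDeriv_log_restrictedInteraction_cgf χ hp P B hG hΦ h0 hv hvar hc₀ hcb hW hK
      hek β
  set g : ℝ → ℝ := iteratedDerivWithin α f (Set.Icc 0 1) with hgdef
  have hg0 : g 0 = iteratedDeriv α (cgf (fun ω => -W ω) P) 0 :=
    iteratedDerivWithin_log_restrictedInteraction_zero χ hp P B hG hΦ h0 hv hvar hc₀ hcb hW hK hek hek1 hz α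
  have hloc : ∀ t ∈ Set.Ioo (0 : ℝ) 1, g =ᶠ[𝓝 t] iteratedDeriv α f := fun t ht => by
    filter_upwards [isOpen_Ioo.mem_nhds ht] with s hs using hB α s hs
  have h1 : DifferentiableOn ℝ g (Set.Ioo 0 1) := fun t ht =>
    ((hloc t ht).differentiableAt_iff.mpr (differentiableAt_iteratedDeriv_of_contDiffAt
      (BIJ88PerturbativeRemainder308.contDiffAt_log_restrictedInteraction χ p P B hΦ hcne hW hK hek hek1 hz (α + 1)
        ⟨ht.1, ht.2.le⟩))).differentiableWithinAt
  have h2 : ContinuousWithinAt g (Set.Ioo 0 1) 0 := by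
    rw [ContinuousWithinAt, nhdsWithin_Ioo_eq_nhdsGT zero_lt_one, hg0]
    refine (hlim α).congr' ?_
    filter_upwards [Ioo_mem_nhdsGT zero_lt_one] with t ht using (hB α t ht).symm
  have h3 : Tendsto (fun t => deriv g t) (𝓝[>] (0 : ℝ)) (𝓝 (iteratedDeriv (α + 1) (cgf (fun ω => -W ω) P) 0)) := by
    refine (hlim (α + 1)).congr' ?_
    filter_upwards [Ioo_mem_nhdsGT zero_lt_one] with t ht
    rw [(hloc t ht).deriv_eq, iteratedDeriv_succ]
  exact (hasDerivWithinAt_Ici_of_tendsto_deriv h1 h2 (Ioo_mem_nhdsGT zero_lt_one) h3).mono Set.Icc_subset_Ici_self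

/-- **Every within-`[0,1]` iterated derivative of `log z_t` is differentiable on `[0,1]`** (right derivative at `0` from the previous
theorem; ordinary derivatives on `(0,1]`). [cite: BalabanImbrieJaffe1988, (5.14.1) p.308] -/
theorem differentiableOn_iteratedDerivWithin_log {p : ℝ} (hp : 1 / 2 < p) (P : Measure Ω) [IsProbabilityMeasure P]
    (B : Finset ι) {Φ : ι → Ω → ℝ} (hG : ∀ b ∈ B, HasGaussianLaw (Φ b) P) (hΦ : ∀ b ∈ B, Measurable (Φ b))
    (h0 : ∀ b ∈ B, P[Φ b] = 0) {v : ℝ} (hv : 0 < v) (hvar : ∀ b ∈ B, Var[Φ b; P] ≤ v) {c : ι → ℝ} {c₀ : ℝ} (hc₀ : 0 < c₀)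
    (hcb : ∀ b ∈ B, c₀ ≤ c b) {W : Ω → ℝ} (hW : Measurable W) {K : ℝ} (hK : ∀ ω, |W ω| ≤ K) {ek : ℝ} (hek : 0 < ek)
    (hek1 : ek < Real.exp (-1))
    (hz : ∀ t ∈ Set.Ioc (0 : ℝ) 1, (∫ ω, (∏ b ∈ B, cutoff χ (c b * pLog p (t * ek)) (Φ b ω)) * Real.exp (-(t * W ω)) ∂P) ≠ 0)
    (α : ℕ) :
    DifferentiableOn ℝ (iteratedDerivWithin α (fun t => Real.log
        (∫ ω, (∏ b ∈ B, cutoff χ (c b * pLog p (t * ek)) (Φ b ω)) * Real.exp (-(t * W ω)) ∂P)) (Set.Icc 0 1)) (Set.Icc 0 1) := by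
  have hcne : ∀ b ∈ B, c b ≠ 0 := fun b hb => (hc₀.trans_le (hcb b hb)).ne'
  intro t ht
  rcases eq_or_lt_of_le ht.1 with h0t | hpos
  · rw [← h0t]
    exact (hasDerivWithinAt_iteratedDerivWithin_log_zero χ hp P B hG hΦ h0 hv hvar hc₀ hcb hW hK hek hek1 hz α).differentiableWithinAt
  · have hB : ∀ s ∈ Set.Ioc (0 : ℝ) 1, iteratedDerivWithin α (fun t => Real.log
        (∫ ω, (∏ b ∈ B, cutoff χ (c b * pLog p (t * ek)) (Φ b ω)) * Real.exp (-(t * W ω)) ∂P)) (Set.Icc 0 1) s =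
        iteratedDeriv α (fun t => Real.log
          (∫ ω, (∏ b ∈ B, cutoff χ (c b * pLog p (t * ek)) (Φ b ω)) * Real.exp (-(t * W ω)) ∂P)) s :=
      fun s hs => iteratedDerivWithin_Icc_log_restrictedInteraction χ p P B hΦ hcne hW hK hek hek1 hz α hs
    have hd := differentiableAt_iteratedDeriv_of_contDiffAt
      (BIJ88PerturbativeRemainder308.contDiffAt_log_restrictedInteraction χ p P B hΦ hcne hW hK hek hek1 hz (α + 1) ⟨hpos, ht.2⟩)
    refine hd.differentiableWithinAt.congr_of_eventuallyEq ?_ (hB t ⟨hpos, ht.2⟩)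
    have hmem : Set.Ioc (0 : ℝ) 1 ∈ 𝓝[Set.Icc 0 1] t :=
      mem_nhdsWithin.mpr ⟨Set.Ioi 0, isOpen_Ioi, hpos, fun s hs => ⟨hs.1, hs.2.2⟩⟩
    filter_upwards [hmem] with s hs using hB s hs

/-- **`t ↦ log z_t` is `Cⁿ` on the CLOSED interval `[0,1]` for every `n`** — the one-sided smooth extension at the Gaussian point `t = 0`
(hypotheses as above): the regularity under which the row owner's `BIJ88Sect5StatementsPart4.taylor_logz` (Taylor's formula on `[0,1]`,
(5.14.2)) applies verbatim. [cite: BalabanImbrieJaffe1988, (5.14.2) p.308] -/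
theorem contDiffOn_Icc_log_restrictedInteraction {p : ℝ} (hp : 1 / 2 < p) (P : Measure Ω) [IsProbabilityMeasure P]
    (B : Finset ι) {Φ : ι → Ω → ℝ} (hG : ∀ b ∈ B, HasGaussianLaw (Φ b) P) (hΦ : ∀ b ∈ B, Measurable (Φ b))
    (h0 : ∀ b ∈ B, P[Φ b] = 0) {v : ℝ} (hv : 0 < v) (hvar : ∀ b ∈ B, Var[Φ b; P] ≤ v) {c : ι → ℝ} {c₀ : ℝ} (hc₀ : 0 < c₀)
    (hcb : ∀ b ∈ B, c₀ ≤ c b) {W : Ω → ℝ} (hW : Measurable W) {K : ℝ} (hK : ∀ ω, |W ω| ≤ K) {ek : ℝ} (hek : 0 < ek)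
    (hek1 : ek < Real.exp (-1))
    (hz : ∀ t ∈ Set.Ioc (0 : ℝ) 1, (∫ ω, (∏ b ∈ B, cutoff χ (c b * pLog p (t * ek)) (Φ b ω)) * Real.exp (-(t * W ω)) ∂P) ≠ 0)
    (n : ℕ) :
    ContDiffOn ℝ n (fun t => Real.log
        (∫ ω, (∏ b ∈ B, cutoff χ (c b * pLog p (t * ek)) (Φ b ω)) * Real.exp (-(t * W ω)) ∂P)) (Set.Icc 0 1) := by
  set f : ℝ → ℝ := fun t => Real.log
    (∫ ω, (∏ b ∈ B, cutoff χ (c b * pLog p (t * ek)) (Φ b ω)) * Real.exp (-(t * W ω)) ∂P) with hfdef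
  have hdiff : ∀ m : ℕ, DifferentiableOn ℝ (iteratedDerivWithin m f (Set.Icc 0 1)) (Set.Icc 0 1) := fun m =>
    differentiableOn_iteratedDerivWithin_log χ hp P B hG hΦ h0 hv hvar hc₀ hcb hW hK hek hek1 hz m
  have key : ∀ n m : ℕ, ContDiffOn ℝ n (iteratedDerivWithin m f (Set.Icc 0 1)) (Set.Icc 0 1) := by
    intro n
    induction n with
    | zero => exact fun m => contDiffOn_zero.mpr (hdiff m).continuousOn
    | succ n ih =>
      intro m
      rw [Nat.cast_succ, contDiffOn_succ_iff_derivWithin (uniqueDiffOn_Icc zero_lt_one)]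
      refine ⟨hdiff m, fun h => absurd h (by exact_mod_cast WithTop.natCast_ne_top n), ?_⟩
      rw [← iteratedDerivWithin_succ]
      exact ih (m + 1)
  have h := key n 0
  rwa [iteratedDerivWithin_zero] at h

end OneSided

/-! ## §3 The typed leaves of row C2.Eq5.14.1-5.14.2 inhabited by the actual family -/

section Typed

variable (χ : CutoffProfile) {ι Ω : Type*} [MeasurableSpace Ω]

/-- **Print's `𝒫_{k+1}` AS TYPED equals the Gaussian-cumulant sum**: `pertP (log z) n̄ = pertPart n̄ (cgf_{−W})` — the row owner's leaf
`BIJ88Sect5StatementsPart4.pertP` (derivatives AT `t = 0` within `[0,1]`) evaluated on the restricted interacting family is the `𝒫` of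
`BIJ88GaussianMoments308`/`BIJ88EffectiveAction308` (hypotheses as in §2). [cite: BalabanImbrieJaffe1988, (5.14.1) p.308] -/
theorem pertP_restrictedInteraction {p : ℝ} (hp : 1 / 2 < p) (P : Measure Ω) [IsProbabilityMeasure P]
    (B : Finset ι) {Φ : ι → Ω → ℝ} (hG : ∀ b ∈ B, HasGaussianLaw (Φ b) P) (hΦ : ∀ b ∈ B, Measurable (Φ b))
    (h0 : ∀ b ∈ B, P[Φ b] = 0) {v : ℝ} (hv : 0 < v) (hvar : ∀ b ∈ B, Var[Φ b; P] ≤ v) {c : ι → ℝ} {c₀ : ℝ} (hc₀ : 0 < c₀)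
    (hcb : ∀ b ∈ B, c₀ ≤ c b) {W : Ω → ℝ} (hW : Measurable W) {K : ℝ} (hK : ∀ ω, |W ω| ≤ K) {ek : ℝ} (hek : 0 < ek)
    (hek1 : ek < Real.exp (-1))
    (hz : ∀ t ∈ Set.Ioc (0 : ℝ) 1, (∫ ω, (∏ b ∈ B, cutoff χ (c b * pLog p (t * ek)) (Φ b ω)) * Real.exp (-(t * W ω)) ∂P) ≠ 0)
    (nbar : ℕ) :
    pertP (fun t => Real.log (∫ ω, (∏ b ∈ B, cutoff χ (c b * pLog p (t * ek)) (Φ b ω)) * Real.exp (-(t * W ω)) ∂P)) nbar =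
      pertPart nbar (cgf (fun ω => -W ω) P) := by
  rw [pertP, BIJ88Perturbative341.pertPart_def, Set.uIcc_of_le zero_le_one]
  refine Finset.sum_congr rfl fun α _ => ?_
  rw [iteratedDerivWithin_log_restrictedInteraction_zero χ hp P B hG hΦ h0 hv hvar hc₀ hcb hW hK hek hek1 hz (α + 1)]
  ring

/-- **The row owner's Taylor formula (5.14.2) `taylor_logz` applied verbatim to the restricted interacting family** (`log z_0 = 0`):
`log z₁ = −pertP (log z) n̄ + ∫₀¹ ((1−t)^{n̄}/n̄!)·iteratedDerivWithin (n̄+1) (log z) [0,1] t dt` (hypotheses as in §2).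
[cite: BalabanImbrieJaffe1988, (5.14.2) p.308] -/
theorem taylor_logz_restrictedInteraction {p : ℝ} (hp : 1 / 2 < p) (P : Measure Ω) [IsProbabilityMeasure P]
    (B : Finset ι) {Φ : ι → Ω → ℝ} (hG : ∀ b ∈ B, HasGaussianLaw (Φ b) P) (hΦ : ∀ b ∈ B, Measurable (Φ b))
    (h0 : ∀ b ∈ B, P[Φ b] = 0) {v : ℝ} (hv : 0 < v) (hvar : ∀ b ∈ B, Var[Φ b; P] ≤ v) {c : ι → ℝ} {c₀ : ℝ} (hc₀ : 0 < c₀)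
    (hcb : ∀ b ∈ B, c₀ ≤ c b) {W : Ω → ℝ} (hW : Measurable W) {K : ℝ} (hK : ∀ ω, |W ω| ≤ K) {ek : ℝ} (hek : 0 < ek)
    (hek1 : ek < Real.exp (-1))
    (hz : ∀ t ∈ Set.Ioc (0 : ℝ) 1, (∫ ω, (∏ b ∈ B, cutoff χ (c b * pLog p (t * ek)) (Φ b ω)) * Real.exp (-(t * W ω)) ∂P) ≠ 0)
    (nbar : ℕ) :
    Real.log (∫ ω, (∏ b ∈ B, cutoff χ (c b * pLog p (1 * ek)) (Φ b ω)) * Real.exp (-(1 * W ω)) ∂P) =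
      -pertP (fun t => Real.log (∫ ω, (∏ b ∈ B, cutoff χ (c b * pLog p (t * ek)) (Φ b ω)) * Real.exp (-(t * W ω)) ∂P)) nbar +
        ∫ t in (0 : ℝ)..1, ((1 - t) ^ nbar / nbar.factorial) * iteratedDerivWithin (nbar + 1) (fun t => Real.log
          (∫ ω, (∏ b ∈ B, cutoff χ (c b * pLog p (t * ek)) (Φ b ω)) * Real.exp (-(t * W ω)) ∂P)) (Set.uIcc 0 1) t := by
  have hcd := contDiffOn_Icc_log_restrictedInteraction χ hp P B hG hΦ h0 hv hvar hc₀ hcb hW hK hek hek1 hz (nbar + 1)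
  rw [← Set.uIcc_of_le zero_le_one] at hcd
  have h := BIJ88Sect5StatementsPart4.taylor_logz (nbar := nbar) hcd
  rw [log_integral_restrictedInteraction_at_zero χ (by linarith : p ≠ 0), cgf_zero, zero_sub] at h
  exact h

/-- **The row owner's split `logz_split` — `log z₁ = log z₀ − 𝒫̃_{k+1} − ℛ_k` with `ℛ_k = remR trunc n̄` under the reading
`⟨d/dt;…;d/dt⟩_t = (n̄+1)·(d/dt)^{n̄+1} log z_t` (transcript note T9 at `BIJ88Sect5StatementsPart4.remR`) — applied verbatim to the
restricted interacting family** (`log z_0 = 0`; hypotheses as in §2). [cite: BalabanImbrieJaffe1988, (5.14.2) p.308] -/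
theorem logz_split_restrictedInteraction {p : ℝ} (hp : 1 / 2 < p) (P : Measure Ω) [IsProbabilityMeasure P]
    (B : Finset ι) {Φ : ι → Ω → ℝ} (hG : ∀ b ∈ B, HasGaussianLaw (Φ b) P) (hΦ : ∀ b ∈ B, Measurable (Φ b))
    (h0 : ∀ b ∈ B, P[Φ b] = 0) {v : ℝ} (hv : 0 < v) (hvar : ∀ b ∈ B, Var[Φ b; P] ≤ v) {c : ι → ℝ} {c₀ : ℝ} (hc₀ : 0 < c₀)
    (hcb : ∀ b ∈ B, c₀ ≤ c b) {W : Ω → ℝ} (hW : Measurable W) {K : ℝ} (hK : ∀ ω, |W ω| ≤ K) {ek : ℝ} (hek : 0 < ek)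
    (hek1 : ek < Real.exp (-1))
    (hz : ∀ t ∈ Set.Ioc (0 : ℝ) 1, (∫ ω, (∏ b ∈ B, cutoff χ (c b * pLog p (t * ek)) (Φ b ω)) * Real.exp (-(t * W ω)) ∂P) ≠ 0)
    (nbar : ℕ) :
    Real.log (∫ ω, (∏ b ∈ B, cutoff χ (c b * pLog p (1 * ek)) (Φ b ω)) * Real.exp (-(1 * W ω)) ∂P) =
      0 - pertP (fun t => Real.log (∫ ω, (∏ b ∈ B, cutoff χ (c b * pLog p (t * ek)) (Φ b ω)) * Real.exp (-(t * W ω)) ∂P)) nbar -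
        BIJ88Sect5StatementsPart4.remR (fun t => ((nbar : ℝ) + 1) * iteratedDerivWithin (nbar + 1) (fun t => Real.log
          (∫ ω, (∏ b ∈ B, cutoff χ (c b * pLog p (t * ek)) (Φ b ω)) * Real.exp (-(t * W ω)) ∂P)) (Set.uIcc 0 1) t) nbar := by
  have hcd := contDiffOn_Icc_log_restrictedInteraction χ hp P B hG hΦ h0 hv hvar hc₀ hcb hW hK hek hek1 hz (nbar + 1)
  rw [← Set.uIcc_of_le zero_le_one] at hcd
  have h := BIJ88Sect5StatementsPart4.logz_split (nbar := nbar) hcd (fun _ => rfl)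
  rw [log_integral_restrictedInteraction_at_zero χ (by linarith : p ≠ 0), cgf_zero] at h
  exact h

/-- **(5.14.1)–(5.14.2) AS TYPED, no standing hypothesis**: for a NON-NEGATIVE profile `χ(1,·) ≥ 0`, CENTERED JOINTLY GAUSSIAN fields
(Mathlib `HasGaussianLaw` of `ω ↦ (Φ_b ω)_{b∈Λ}`), `c_b ≥ c₀ > 0`, `p > 1/2`, `0 < e_k < e^{−1}`, measurable `|W| ≤ K`, and every `n̄`, the
effective action of the restricted interacting family is
`−log z₁ = pertP (log z) n̄ − ∫₀¹ ((1−t)^{n̄}/n̄!)·iteratedDerivWithin (n̄+1) (log z) [0,1] t dt`, with `pertP (log z) n̄ = pertPart n̄ (cgf_{−W})`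
the Gaussian cumulants of `−Ṽ` and the integrand continuous on `[0,1]` (`log z ∈ C^∞[0,1]`). [cite: BalabanImbrieJaffe1988, (5.14.2) p.308] -/
theorem effectiveAction_eq_pertP_sub_remainder (hχ : ∀ x, 0 ≤ χ.χ₁ x) {p : ℝ} (hp : 1 / 2 < p) (P : Measure Ω)
    [IsProbabilityMeasure P] (B : Finset ι) {Φ : ι → Ω → ℝ} (hJ : HasGaussianLaw (fun ω (b : B) => Φ b ω) P)
    (hΦ : ∀ b ∈ B, Measurable (Φ b)) (h0 : ∀ b ∈ B, P[Φ b] = 0) {c : ι → ℝ} {c₀ : ℝ} (hc₀ : 0 < c₀) (hcb : ∀ b ∈ B, c₀ ≤ c b)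
    {W : Ω → ℝ} (hW : Measurable W) {K : ℝ} (hK : ∀ ω, |W ω| ≤ K) {ek : ℝ} (hek : 0 < ek) (hek1 : ek < Real.exp (-1))
    (nbar : ℕ) :
    -Real.log (∫ ω, (∏ b ∈ B, cutoff χ (c b * pLog p (1 * ek)) (Φ b ω)) * Real.exp (-(1 * W ω)) ∂P) =
      pertP (fun t => Real.log (∫ ω, (∏ b ∈ B, cutoff χ (c b * pLog p (t * ek)) (Φ b ω)) * Real.exp (-(t * W ω)) ∂P)) nbar -
        ∫ t in (0 : ℝ)..1, ((1 - t) ^ nbar / nbar.factorial) * iteratedDerivWithin (nbar + 1) (fun t => Real.log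
          (∫ ω, (∏ b ∈ B, cutoff χ (c b * pLog p (t * ek)) (Φ b ω)) * Real.exp (-(t * W ω)) ∂P)) (Set.uIcc 0 1) t ∧
    pertP (fun t => Real.log (∫ ω, (∏ b ∈ B, cutoff χ (c b * pLog p (t * ek)) (Φ b ω)) * Real.exp (-(t * W ω)) ∂P)) nbar =
      pertPart nbar (cgf (fun ω => -W ω) P) := by
  obtain ⟨hv, hvar⟩ := BIJ88EffectiveAction308.variance_le_one_add_sum P B Φ
  have hG := BIJ88ZtPositivity308.hasGaussianLaw_of_joint P B hJ
  have hp0 : (0 : ℝ) ≤ p := by linarith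
  have hz := BIJ88ZtPositivity308.integral_restrictedInteraction_ne_zero_Ioc χ hχ hp0 P B hJ hΦ h0 hc₀ hcb hW hK hek hek1.le
  refine ⟨?_, pertP_restrictedInteraction χ hp P B hG hΦ h0 hv hvar hc₀ hcb hW hK hek hek1 hz nbar⟩
  have h := taylor_logz_restrictedInteraction χ hp P B hG hΦ h0 hv hvar hc₀ hcb hW hK hek hek1 hz nbar
  linarith

/-- `log z ∈ Cⁿ([0,1])` for every `n`, no standing hypothesis (non-negative profile, centered jointly Gaussian fields).
[cite: BalabanImbrieJaffe1988, (5.14.2) p.308] -/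
theorem contDiffOn_Icc_log_restrictedInteraction' (hχ : ∀ x, 0 ≤ χ.χ₁ x) {p : ℝ} (hp : 1 / 2 < p) (P : Measure Ω)
    [IsProbabilityMeasure P] (B : Finset ι) {Φ : ι → Ω → ℝ} (hJ : HasGaussianLaw (fun ω (b : B) => Φ b ω) P)
    (hΦ : ∀ b ∈ B, Measurable (Φ b)) (h0 : ∀ b ∈ B, P[Φ b] = 0) {c : ι → ℝ} {c₀ : ℝ} (hc₀ : 0 < c₀) (hcb : ∀ b ∈ B, c₀ ≤ c b)
    {W : Ω → ℝ} (hW : Measurable W) {K : ℝ} (hK : ∀ ω, |W ω| ≤ K) {ek : ℝ} (hek : 0 < ek) (hek1 : ek < Real.exp (-1)) (n : ℕ) :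
    ContDiffOn ℝ n (fun t => Real.log
        (∫ ω, (∏ b ∈ B, cutoff χ (c b * pLog p (t * ek)) (Φ b ω)) * Real.exp (-(t * W ω)) ∂P)) (Set.Icc 0 1) := by
  obtain ⟨hv, hvar⟩ := BIJ88EffectiveAction308.variance_le_one_add_sum P B Φ
  exact contDiffOn_Icc_log_restrictedInteraction χ hp P B (BIJ88ZtPositivity308.hasGaussianLaw_of_joint P B hJ) hΦ h0 hv hvar hc₀
    hcb hW hK hek hek1
    (BIJ88ZtPositivity308.integral_restrictedInteraction_ne_zero_Ioc χ hχ (by linarith) P B hJ hΦ h0 hc₀ hcb hW hK hek hek1.le) n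

end Typed

end Literature.MathematicalPhysics.QuantumFieldTheory.BalabanImbrieJaffe1984to88.BIJ88PertTerms5141
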